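/-
Copyright (c) 2026. All rights reserved.
Released under Apache 2.0 license as described in the file LICENSE.
Authors: abc-iut cell, seat abc-iut-L4-t14 (gen 5; proof-only consumer wiring, row «J2-CONSUMER-WIRING»
(L4-lead m59): the PUNCTURED/cusped geometric column of [AbsTopIII] Prop 4.2 (i) / Cor 4.5 at the
uniformised model, `hN`/`hN'` DISCHARGED by abc-iut-L4-d1's cusped normaliser-finiteness theorems).
-/
import Literature.AnabelianGeometry.AbsoluteAnabelian.ArchimedeanHolFieldFunctorGeometricRCPSLSurface
import Literature.AnabelianGeometry.AbsoluteAnabelian.ArchimedeanHolFieldFunctorGeometricPSLNormalizerFiniteCuspedSubgroup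
import HarnessLib

/-!
# [AbsTopIII] Prop 4.2 (i) at the uniformised model, PUNCTURED case: `hN` discharged from the cusps

S. Mochizuki, *Topics in absolute anabelian geometry III*, proof of Prop 4.2 (i) p. 106 l. 14–19 (kurims
`paper:url-5493eb38cbb7`; bib key `MochizukiAbsTopIII2015`): the id-rigidity of `EA` «follows immediately
from the slimness assertion of Lemma 4.3» for `[X/Aut X]`, the finiteness of `Aut X` being used on the way.
The curves `X_v` of [IUTchI–III] are PUNCTURED hyperbolic curves, so at the uniformised model `X = ℍ/Γ̄`
the group `Γ̄` is free and `ℍ/Γ̄` is NOT compact: the finiteness `[N(Λ̄) : Λ̄] < ∞` (abc-iut-L4-t14's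
hypothesis `hN`, campaign-L «J2 (i)») comes from the CUSPS.

PROOF-ONLY consumer wiring (no definition, no named fact; L4-lead m59 «GO L4-t14 J2-CONSUMER-WIRING»).
abc-iut-L4-d1's `HolRS.finiteIndex_subgroupOf_normalizer_of_cusps` (p460349) proves `[N(Γ̄) : Γ̄] < ∞`
for `Γ̄` non-abelian, properly discontinuous, with (P) a parabolic element and (FC) finitely many
`Γ̄`-classes of cusps (cusps typed linear-algebraically as eigenlines of parabolic lifts in `SL(2, ℝ)`),
and `HolRS.finiteIndex_subgroupOf_normalizer_of_cusps_of_le` (p461233) descends it to every non-abelian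
finite-index `Λ̄ ≤ Γ̄` from the cusp data of `Γ̄` alone.  Consumed BY NAME here:

* `HolRS.LocObj.finiteIndex_subgroupOf_normalizer_of_cusps` — **`hN` HOLDS at every object of
  `Loc(PSL₂(ℝ), Γ̄)`** for `Γ̄` free-or-surface, non-abelian, properly discontinuous with (P)+(FC);
* ★★ `HolRS.isIdRigid_EA_mapsTo_pslQuotient_of_cusps` / `HolRS.cor_4_5_geometric_mapsTo_pslQuotient_of_cusps`
  — the holomorphic geometric column over a PUNCTURED `X₀ = ℍ/Γ̄` with hypotheses {`hfin`, (P), (FC)}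
  (plus structure: `Γ̄` free-or-surface, non-abelian, acting freely and properly discontinuously);
* ★★ `HolRS.RC.isIdRigid_EA_mapsTo_pslQuotient_of_cusps` / `HolRS.RC.cor_4_5_geometric_mapsTo_pslQuotient_of_cusps`
  — the PRINT-FAITHFUL (RC) twins, same hypotheses (PSL→PGL normaliser bridge inside
  `RC.isIdRigid_EA_mapsTo_pslQuotient_of_isFreeOrSurface`);
* `…_of_cusps_of_isFreeGroup` forms — `Γ̄` free on finitely many, `≥ 2`, generators (the IUT case), for
  the consumers holding `pslQuotient Λ̄ ≅ X` at genuine `X = ℂ ∖ F`, `E ∖ {x₀}` (abc-iut-w6-d031) once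
  (P)+(FC) (abc-iut-L4-d1) and `hfin` (abc-iut-L4-t12, arithmetic `Λ̄`) are supplied for those `Λ̄`.

HONEST SCOPE.  MODEL side of [AbsTopIII] §4 (model ≠ reconstruction); `hfin` REMAINS a hypothesis here
(discharged for cocompact `Γ̄` in `…GeometricPSLSurface.lean`); orbi objects and `EA` beyond one `X₀`
untouched.  Classical; nothing here bears on [IUTchIII] Cor. 3.12.
-/

set_option autoImplicit false

noncomputable section

open scoped UpperHalfPlane MatrixGroups Matrix
open _root_.MulAction _root_.CategoryTheory
open Literature.IUT.HodgeTheaters (IsFreeOrSurface IsFreeOfFiniteRank)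
open Literature.Geometry.Manifold.QuotientManifold (conjSubgroup)

namespace Literature.AnabelianGeometry.AbsoluteAnabelian

namespace HolRS

variable (Γ : Subgroup PSL2R) [ProperlyDiscontinuousSMul Γ ℍ]

/-! ### `hN` at every object from the cusp data of `Γ̄` -/

variable {Γ} in
/-- **`hN` HOLDS at every object of `Loc(PSL₂(ℝ), Γ̄)` in the cusped case**: for `Γ̄` free-or-surface,
non-abelian, properly discontinuous, with (P) a parabolic element and (FC) finitely many `Γ̄`-classes of
cusps, every finite-index `Λ̄ ≤ Γ̄` has `[N_{PSL₂(ℝ)}(Λ̄) : Λ̄] < ∞` (abc-iut-L4-d1's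
`finiteIndex_subgroupOf_normalizer_of_cusps_of_le`; `Λ̄` non-abelian by
`LocObj.exists_mul_ne_mul_of_isFreeOrSurface`). [cite: MochizukiAbsTopIII2015, Proposition 4.2 (i) proof p.106] -/
theorem LocObj.finiteIndex_subgroupOf_normalizer_of_cusps (hΓ : IsFreeOrSurface Γ)
    (hab : ∃ a b : Γ, a * b ≠ b * a)
    (hP : ∃ t : SL(2, ℝ), QuotientGroup.mk' (Subgroup.center SL(2, ℝ)) t ∈ Γ ∧
      (t : Matrix (Fin 2) (Fin 2) ℝ).IsParabolic)
    (hFC : ∃ F : Finset (Fin 2 → ℝ), ∀ t : SL(2, ℝ),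
      QuotientGroup.mk' (Subgroup.center SL(2, ℝ)) t ∈ Γ → (t : Matrix (Fin 2) (Fin 2) ℝ).IsParabolic →
      ∀ v : Fin 2 → ℝ, v ≠ 0 → (∃ c : ℝ, (t : Matrix (Fin 2) (Fin 2) ℝ) *ᵥ v = c • v) →
      ∃ g : SL(2, ℝ), QuotientGroup.mk' (Subgroup.center SL(2, ℝ)) g ∈ Γ ∧ ∃ w ∈ F, ∃ c : ℝ,
        (g : Matrix (Fin 2) (Fin 2) ℝ) *ᵥ v = c • w)
    (Λ : _root_.Literature.AnabelianGeometry.AbsoluteAnabelian.LocObj Γ) :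
    (Λ.toSubgroup.subgroupOf (Subgroup.normalizer (Λ.toSubgroup : Set PSL2R))).FiniteIndex := by
  haveI : (Λ.toSubgroup.subgroupOf Γ).FiniteIndex := Λ.finiteIndex
  exact finiteIndex_subgroupOf_normalizer_of_cusps_of_le Γ Λ.toSubgroup Λ.le
    (HolRS.LocObj.exists_mul_ne_mul_of_isFreeOrSurface hΓ hab Λ) hP hFC

/-! ### The PUNCTURED column: holomorphic and RC -/

variable [IsCancelSMul Γ ℍ]
  (hfin : ∀ (g : PSL2R) (Λ₁ Λ₂ : _root_.Literature.AnabelianGeometry.AbsoluteAnabelian.LocObj Γ),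
    (∀ x ∈ Λ₁.toSubgroup, g * x * g⁻¹ ∈ Λ₂.toSubgroup) →
    ((conjSubgroup g Λ₁.toSubgroup).subgroupOf Λ₂.toSubgroup).FiniteIndex)

include hfin

/-- ★★ **[AbsTopIII] Prop 4.2 (i) at the uniformised model, PUNCTURED case: the geometric `EA` over
`X₀ = ℍ/Γ̄` is ID-RIGID** for `Γ̄` free-or-surface, non-abelian, acting freely and properly discontinuously,
with (P) a parabolic and (FC) finitely many cusp classes — `hN` DISCHARGED (abc-iut-L4-d1); remaining
hypothesis `hfin`. [cite: MochizukiAbsTopIII2015, Proposition 4.2 (i) proof p.106] -/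
theorem isIdRigid_EA_mapsTo_pslQuotient_of_cusps (hΓ : IsFreeOrSurface Γ) (hab : ∃ a b : Γ, a * b ≠ b * a)
    (hP : ∃ t : SL(2, ℝ), QuotientGroup.mk' (Subgroup.center SL(2, ℝ)) t ∈ Γ ∧
      (t : Matrix (Fin 2) (Fin 2) ℝ).IsParabolic)
    (hFC : ∃ F : Finset (Fin 2 → ℝ), ∀ t : SL(2, ℝ),
      QuotientGroup.mk' (Subgroup.center SL(2, ℝ)) t ∈ Γ → (t : Matrix (Fin 2) (Fin 2) ℝ).IsParabolic →
      ∀ v : Fin 2 → ℝ, v ≠ 0 → (∃ c : ℝ, (t : Matrix (Fin 2) (Fin 2) ℝ) *ᵥ v = c • v) →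
      ∃ g : SL(2, ℝ), QuotientGroup.mk' (Subgroup.center SL(2, ℝ)) g ∈ Γ ∧ ∃ w ∈ F, ∃ c : ℝ,
        (g : Matrix (Fin 2) (Fin 2) ℝ) *ᵥ v = c • w) :
    IsIdRigid (geometricAutHolFieldFunctor fun Y : HolRS => Nonempty (Y ⟶ pslQuotient Γ)).EA :=
  isIdRigid_EA_mapsTo_pslQuotient_of_isFreeOrSurface Γ hfin hΓ hab
    (LocObj.finiteIndex_subgroupOf_normalizer_of_cusps hΓ hab hP hFC)

/-- ★★ **[AbsTopIII] Cor 4.5 (i)–(v) over a PUNCTURED `X₀ = ℍ/Γ̄`**, `Γ̄` free-or-surface, non-abelian,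
acting freely and properly discontinuously, with (P)+(FC) — `hN` discharged; remaining hypothesis `hfin`.
[cite: MochizukiAbsTopIII2015, Corollary 4.5 pp.107–109] -/
theorem cor_4_5_geometric_mapsTo_pslQuotient_of_cusps (hΓ : IsFreeOrSurface Γ)
    (hab : ∃ a b : Γ, a * b ≠ b * a)
    (hP : ∃ t : SL(2, ℝ), QuotientGroup.mk' (Subgroup.center SL(2, ℝ)) t ∈ Γ ∧
      (t : Matrix (Fin 2) (Fin 2) ℝ).IsParabolic)
    (hFC : ∃ F : Finset (Fin 2 → ℝ), ∀ t : SL(2, ℝ),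
      QuotientGroup.mk' (Subgroup.center SL(2, ℝ)) t ∈ Γ → (t : Matrix (Fin 2) (Fin 2) ℝ).IsParabolic →
      ∀ v : Fin 2 → ℝ, v ≠ 0 → (∃ c : ℝ, (t : Matrix (Fin 2) (Fin 2) ℝ) *ᵥ v = c • v) →
      ∃ g : SL(2, ℝ), QuotientGroup.mk' (Subgroup.center SL(2, ℝ)) g ∈ Γ ∧ ∃ w ∈ F, ∃ c : ℝ,
        (g : Matrix (Fin 2) (Fin 2) ℝ) *ᵥ v = c • w) :
    Literature.AnabelianGeometry.AbsoluteAnabelian.AbsTopIII.Cor_4_5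
      (archLogFrobeniusData (geometricAutHolFieldFunctor fun Y : HolRS => Nonempty (Y ⟶ pslQuotient Γ)))
      (archTelecoreData (geometricAutHolFieldFunctor fun Y : HolRS => Nonempty (Y ⟶ pslQuotient Γ))) :=
  cor_4_5_geometric_mapsTo_pslQuotient_of_isFreeOrSurface Γ hfin hΓ hab
    (LocObj.finiteIndex_subgroupOf_normalizer_of_cusps hΓ hab hP hFC)

/-- ★★ **[AbsTopIII] Prop 4.2 (i), PRINT-FAITHFUL (RC) morphisms, PUNCTURED case**: the geometric `EA` of
the RC instance over `X₀ = ℍ/Γ̄` is ID-RIGID, same hypotheses — `hN'` DISCHARGED (abc-iut-L4-d1 + PSL→PGL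
bridge); remaining hypothesis `hfin`. [cite: MochizukiAbsTopIII2015, Proposition 4.2 (i) proof p.106] -/
theorem RC.isIdRigid_EA_mapsTo_pslQuotient_of_cusps (hΓ : IsFreeOrSurface Γ)
    (hab : ∃ a b : Γ, a * b ≠ b * a)
    (hP : ∃ t : SL(2, ℝ), QuotientGroup.mk' (Subgroup.center SL(2, ℝ)) t ∈ Γ ∧
      (t : Matrix (Fin 2) (Fin 2) ℝ).IsParabolic)
    (hFC : ∃ F : Finset (Fin 2 → ℝ), ∀ t : SL(2, ℝ),
      QuotientGroup.mk' (Subgroup.center SL(2, ℝ)) t ∈ Γ → (t : Matrix (Fin 2) (Fin 2) ℝ).IsParabolic →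
      ∀ v : Fin 2 → ℝ, v ≠ 0 → (∃ c : ℝ, (t : Matrix (Fin 2) (Fin 2) ℝ) *ᵥ v = c • v) →
      ∃ g : SL(2, ℝ), QuotientGroup.mk' (Subgroup.center SL(2, ℝ)) g ∈ Γ ∧ ∃ w ∈ F, ∃ c : ℝ,
        (g : Matrix (Fin 2) (Fin 2) ℝ) *ᵥ v = c • w) :
    IsIdRigid (geometricAutHolFieldFunctorRC fun Y : RC => Nonempty (Y ⟶ toRC.obj (pslQuotient Γ))).EA :=
  RC.isIdRigid_EA_mapsTo_pslQuotient_of_isFreeOrSurface Γ hfin hΓ hab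
    (LocObj.finiteIndex_subgroupOf_normalizer_of_cusps hΓ hab hP hFC)

/-- ★★ **[AbsTopIII] Cor 4.5 (i)–(v), PRINT-FAITHFUL morphisms, over a PUNCTURED `X₀ = ℍ/Γ̄`**, `Γ̄`
free-or-surface, non-abelian, acting freely and properly discontinuously, with (P)+(FC) — `hN'`
discharged; remaining hypothesis `hfin`. [cite: MochizukiAbsTopIII2015, Corollary 4.5 pp.107–109] -/
theorem RC.cor_4_5_geometric_mapsTo_pslQuotient_of_cusps (hΓ : IsFreeOrSurface Γ)
    (hab : ∃ a b : Γ, a * b ≠ b * a)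
    (hP : ∃ t : SL(2, ℝ), QuotientGroup.mk' (Subgroup.center SL(2, ℝ)) t ∈ Γ ∧
      (t : Matrix (Fin 2) (Fin 2) ℝ).IsParabolic)
    (hFC : ∃ F : Finset (Fin 2 → ℝ), ∀ t : SL(2, ℝ),
      QuotientGroup.mk' (Subgroup.center SL(2, ℝ)) t ∈ Γ → (t : Matrix (Fin 2) (Fin 2) ℝ).IsParabolic →
      ∀ v : Fin 2 → ℝ, v ≠ 0 → (∃ c : ℝ, (t : Matrix (Fin 2) (Fin 2) ℝ) *ᵥ v = c • v) →
      ∃ g : SL(2, ℝ), QuotientGroup.mk' (Subgroup.center SL(2, ℝ)) g ∈ Γ ∧ ∃ w ∈ F, ∃ c : ℝ,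
        (g : Matrix (Fin 2) (Fin 2) ℝ) *ᵥ v = c • w) :
    Literature.AnabelianGeometry.AbsoluteAnabelian.AbsTopIII.Cor_4_5
      (archLogFrobeniusData
        (geometricAutHolFieldFunctorRC fun Y : RC => Nonempty (Y ⟶ toRC.obj (pslQuotient Γ))))
      (archTelecoreData
        (geometricAutHolFieldFunctorRC fun Y : RC => Nonempty (Y ⟶ toRC.obj (pslQuotient Γ)))) :=
  RC.cor_4_5_geometric_mapsTo_pslQuotient_of_isFreeOrSurface Γ hfin hΓ hab
    (LocObj.finiteIndex_subgroupOf_normalizer_of_cusps hΓ hab hP hFC)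

/-! ### The IUT shape: `Γ̄` free on finitely many (`≥ 2`) generators -/

omit [ProperlyDiscontinuousSMul Γ ℍ] [IsCancelSMul Γ ℍ] hfin in
/-- A group free on finitely many generators is «free of finite rank» in abc-iut-L5's sense
(`≃* FreeGroup (Fin n)`). [cite: Mochizuki2012, Thm 2.6 p.56] -/
theorem isFreeOfFiniteRank_of_isFreeGroup [IsFreeGroup Γ] [Finite (IsFreeGroup.Generators Γ)] :
    IsFreeOfFiniteRank Γ :=
  ⟨_, ⟨(IsFreeGroup.toFreeGroup Γ).trans
    (FreeGroup.freeGroupCongr (Finite.equivFin (IsFreeGroup.Generators Γ)))⟩⟩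

/-- ★★ **The PUNCTURED column in the IUT shape**: for `Γ̄ ≤ PSL₂(ℝ)` free on finitely many, `≥ 2`,
generators, acting freely and properly discontinuously on `ℍ`, with (P)+(FC), the geometric `EA` over
`X₀ = ℍ/Γ̄` is ID-RIGID — p449027 with `hN` DISCHARGED; remaining hypothesis `hfin`.
[cite: MochizukiAbsTopIII2015, Proposition 4.2 (i) proof p.106] -/
theorem isIdRigid_EA_mapsTo_pslQuotient_of_cusps_of_isFreeGroup [IsFreeGroup Γ]
    [Finite (IsFreeGroup.Generators Γ)] (h2 : 2 ≤ Nat.card (IsFreeGroup.Generators Γ))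
    (hP : ∃ t : SL(2, ℝ), QuotientGroup.mk' (Subgroup.center SL(2, ℝ)) t ∈ Γ ∧
      (t : Matrix (Fin 2) (Fin 2) ℝ).IsParabolic)
    (hFC : ∃ F : Finset (Fin 2 → ℝ), ∀ t : SL(2, ℝ),
      QuotientGroup.mk' (Subgroup.center SL(2, ℝ)) t ∈ Γ → (t : Matrix (Fin 2) (Fin 2) ℝ).IsParabolic →
      ∀ v : Fin 2 → ℝ, v ≠ 0 → (∃ c : ℝ, (t : Matrix (Fin 2) (Fin 2) ℝ) *ᵥ v = c • v) →
      ∃ g : SL(2, ℝ), QuotientGroup.mk' (Subgroup.center SL(2, ℝ)) g ∈ Γ ∧ ∃ w ∈ F, ∃ c : ℝ,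
        (g : Matrix (Fin 2) (Fin 2) ℝ) *ᵥ v = c • w) :
    IsIdRigid (geometricAutHolFieldFunctor fun Y : HolRS => Nonempty (Y ⟶ pslQuotient Γ)).EA :=
  isIdRigid_EA_mapsTo_pslQuotient_of_cusps Γ hfin (Or.inl (isFreeOfFiniteRank_of_isFreeGroup Γ))
    (by
      obtain ⟨x, y, hxy⟩ := HolRS.LocObj.exists_mul_ne_mul h2 (LocObj.top Γ)
      exact ⟨⟨x, x.2⟩, ⟨y, y.2⟩, fun h => hxy (Subtype.ext (congrArg Subtype.val h))⟩) hP hFC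

/-- ★★ **Cor 4.5 (i)–(v) in the IUT shape** (`Γ̄` free on finitely many, `≥ 2`, generators; (P)+(FC);
remaining hypothesis `hfin`). [cite: MochizukiAbsTopIII2015, Corollary 4.5 pp.107–109] -/
theorem cor_4_5_geometric_mapsTo_pslQuotient_of_cusps_of_isFreeGroup [IsFreeGroup Γ]
    [Finite (IsFreeGroup.Generators Γ)] (h2 : 2 ≤ Nat.card (IsFreeGroup.Generators Γ))
    (hP : ∃ t : SL(2, ℝ), QuotientGroup.mk' (Subgroup.center SL(2, ℝ)) t ∈ Γ ∧
      (t : Matrix (Fin 2) (Fin 2) ℝ).IsParabolic)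
    (hFC : ∃ F : Finset (Fin 2 → ℝ), ∀ t : SL(2, ℝ),
      QuotientGroup.mk' (Subgroup.center SL(2, ℝ)) t ∈ Γ → (t : Matrix (Fin 2) (Fin 2) ℝ).IsParabolic →
      ∀ v : Fin 2 → ℝ, v ≠ 0 → (∃ c : ℝ, (t : Matrix (Fin 2) (Fin 2) ℝ) *ᵥ v = c • v) →
      ∃ g : SL(2, ℝ), QuotientGroup.mk' (Subgroup.center SL(2, ℝ)) g ∈ Γ ∧ ∃ w ∈ F, ∃ c : ℝ,
        (g : Matrix (Fin 2) (Fin 2) ℝ) *ᵥ v = c • w) :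
    Literature.AnabelianGeometry.AbsoluteAnabelian.AbsTopIII.Cor_4_5
      (archLogFrobeniusData (geometricAutHolFieldFunctor fun Y : HolRS => Nonempty (Y ⟶ pslQuotient Γ)))
      (archTelecoreData (geometricAutHolFieldFunctor fun Y : HolRS => Nonempty (Y ⟶ pslQuotient Γ))) :=
  cor_4_5_geometric_mapsTo_pslQuotient_of_cusps Γ hfin (Or.inl (isFreeOfFiniteRank_of_isFreeGroup Γ))
    (by
      obtain ⟨x, y, hxy⟩ := HolRS.LocObj.exists_mul_ne_mul h2 (LocObj.top Γ)
      exact ⟨⟨x, x.2⟩, ⟨y, y.2⟩, fun h => hxy (Subtype.ext (congrArg Subtype.val h))⟩) hP hFC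

/-- ★★ **The PRINT-FAITHFUL (RC) column in the IUT shape** (`Γ̄` free on finitely many, `≥ 2`,
generators; (P)+(FC); remaining hypothesis `hfin`) — abc-iut-L4-t14's p456078 closer with `hN'` DISCHARGED.
[cite: MochizukiAbsTopIII2015, Proposition 4.2 (i) proof p.106] -/
theorem RC.isIdRigid_EA_mapsTo_pslQuotient_of_cusps_of_isFreeGroup [IsFreeGroup Γ]
    [Finite (IsFreeGroup.Generators Γ)] (h2 : 2 ≤ Nat.card (IsFreeGroup.Generators Γ))
    (hP : ∃ t : SL(2, ℝ), QuotientGroup.mk' (Subgroup.center SL(2, ℝ)) t ∈ Γ ∧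
      (t : Matrix (Fin 2) (Fin 2) ℝ).IsParabolic)
    (hFC : ∃ F : Finset (Fin 2 → ℝ), ∀ t : SL(2, ℝ),
      QuotientGroup.mk' (Subgroup.center SL(2, ℝ)) t ∈ Γ → (t : Matrix (Fin 2) (Fin 2) ℝ).IsParabolic →
      ∀ v : Fin 2 → ℝ, v ≠ 0 → (∃ c : ℝ, (t : Matrix (Fin 2) (Fin 2) ℝ) *ᵥ v = c • v) →
      ∃ g : SL(2, ℝ), QuotientGroup.mk' (Subgroup.center SL(2, ℝ)) g ∈ Γ ∧ ∃ w ∈ F, ∃ c : ℝ,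
        (g : Matrix (Fin 2) (Fin 2) ℝ) *ᵥ v = c • w) :
    IsIdRigid (geometricAutHolFieldFunctorRC fun Y : RC => Nonempty (Y ⟶ toRC.obj (pslQuotient Γ))).EA :=
  RC.isIdRigid_EA_mapsTo_pslQuotient_of_cusps Γ hfin (Or.inl (isFreeOfFiniteRank_of_isFreeGroup Γ))
    (by
      obtain ⟨x, y, hxy⟩ := HolRS.LocObj.exists_mul_ne_mul h2 (LocObj.top Γ)
      exact ⟨⟨x, x.2⟩, ⟨y, y.2⟩, fun h => hxy (Subtype.ext (congrArg Subtype.val h))⟩) hP hFC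

/-- ★★ **Cor 4.5 (i)–(v), PRINT-FAITHFUL morphisms, in the IUT shape** (`Γ̄` free on finitely many,
`≥ 2`, generators; (P)+(FC); remaining hypothesis `hfin`). [cite: MochizukiAbsTopIII2015, Corollary 4.5 pp.107–109] -/
theorem RC.cor_4_5_geometric_mapsTo_pslQuotient_of_cusps_of_isFreeGroup [IsFreeGroup Γ]
    [Finite (IsFreeGroup.Generators Γ)] (h2 : 2 ≤ Nat.card (IsFreeGroup.Generators Γ))
    (hP : ∃ t : SL(2, ℝ), QuotientGroup.mk' (Subgroup.center SL(2, ℝ)) t ∈ Γ ∧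
      (t : Matrix (Fin 2) (Fin 2) ℝ).IsParabolic)
    (hFC : ∃ F : Finset (Fin 2 → ℝ), ∀ t : SL(2, ℝ),
      QuotientGroup.mk' (Subgroup.center SL(2, ℝ)) t ∈ Γ → (t : Matrix (Fin 2) (Fin 2) ℝ).IsParabolic →
      ∀ v : Fin 2 → ℝ, v ≠ 0 → (∃ c : ℝ, (t : Matrix (Fin 2) (Fin 2) ℝ) *ᵥ v = c • v) →
      ∃ g : SL(2, ℝ), QuotientGroup.mk' (Subgroup.center SL(2, ℝ)) g ∈ Γ ∧ ∃ w ∈ F, ∃ c : ℝ,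
        (g : Matrix (Fin 2) (Fin 2) ℝ) *ᵥ v = c • w) :
    Literature.AnabelianGeometry.AbsoluteAnabelian.AbsTopIII.Cor_4_5
      (archLogFrobeniusData
        (geometricAutHolFieldFunctorRC fun Y : RC => Nonempty (Y ⟶ toRC.obj (pslQuotient Γ))))
      (archTelecoreData
        (geometricAutHolFieldFunctorRC fun Y : RC => Nonempty (Y ⟶ toRC.obj (pslQuotient Γ)))) :=
  RC.cor_4_5_geometric_mapsTo_pslQuotient_of_cusps Γ hfin (Or.inl (isFreeOfFiniteRank_of_isFreeGroup Γ))
    (by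
      obtain ⟨x, y, hxy⟩ := HolRS.LocObj.exists_mul_ne_mul h2 (LocObj.top Γ)
      exact ⟨⟨x, x.2⟩, ⟨y, y.2⟩, fun h => hxy (Subtype.ext (congrArg Subtype.val h))⟩) hP hFC

end HolRS

end Literature.AnabelianGeometry.AbsoluteAnabelian

end
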